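import Summits.RiemannHypothesis.RiemannHypothesis.Theorems.SuzukiThetaFlowDefs
import Summits.RiemannHypothesis.RiemannHypothesis.Theorems.SuzukiCleanRadiusDefs
import Summits.RiemannHypothesis.RiemannHypothesis.Theorems.WeilFormatCDataA1RungCB
import Literature.NumberTheory.LFunctions.WeilArchimedeanPositivityProofs

/-!
# SuzukiThetaFlow — the logic of the `theta-flow-weil-window` chain, kernel-checked modulo two named analytic
statements and one numerical anchor (column DBR; RH-FREE; defs verbatim from the card + the monotonicity step)

RH-FREE throughout; nothing here bears on the truth of RH.  `RungTwelveOne` (`∀ θ ≥ 12, CleanUpTo θ 1`) is a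
θ-uniform instance family of the matrix of the RH-EQUIVALENT·DERIVED residual `AllWindowsWitness` (stmt-19733), NOT the
residual; the `∀ t` level of `NormSqAntitone` is Weil's criterion re-indexed (declared by the card, not claimed).

The cell's crux idea `theta-flow-weil-window` (rh-dbr-idea-2 g2; HOME/rh-dbr-idea-2/g2-Sketch.lean, statements copied
VERBATIM with their names) runs: (T0) `ThetaFlowIdentity` ⇒ [with Weil positivity on the window outputs] (T1)
`NormSqAntitone` ⇒ [with one certified anchor `‖𝖪₁₂[t]‖² ≤ q < 1`, ET1b, and `ContractionExcludes`] `RungTwelveOne`.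
In the tree: (T0) ⟸ `FlowPairing` (`Theorems.SuzukiThetaFlowDefs.thetaFlowIdentity_of_flowPairing`, on top of
`Theorems.SuzukiWindowThetaFlow.hasDerivAt_winNormSq`).  This file adds the CALCULUS step (T0) + positivity ⇒ (T1)
(`normSqAntitone_of_flow`: a function on `(1,∞)` with non-positive derivative is antitone, `antitoneOn_of_deriv_nonpos`),
the card's own pure-logic steps (`contractionExcludes`, `uniformCleanWindow_of_antitone_anchor`, `rung_of`, proofs
idea-2's), and the assembly `rungTwelveOne_of_flowPairing`: **`RungTwelveOne` ⟸ `FlowPairing` on the windows `t ≤ 1` +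
`WeilNonnegOnOutputs` on `t ≤ 1` + `Anchor 12 1`** — the Weil input being the TREE theorem
`WeilFormatCData.A1.weilPositivityOn_one` (RH-free).  What is NOT in the tree: `FlowPairing` (explicit-formula
bookkeeping), `WeilNonnegOnOutputs` (extension of Weil positivity from smooth tests to window outputs),
`Anchor 12 1` (kit-certified, ET1b; two lineages, not a Lean theorem).

References: [Su20] M. Suzuki, ASPM 84 (2020) = arXiv:1907.07302; A. Weil (1952); E. Bombieri, Rend. Lincei (9) 11 (2000).
-/

noncomputable section

-- D-0017: `Summit.<S>.<S>.…` is the designed namespace of a single-problem summit.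
set_option linter.dupNamespace false

open Complex MeasureTheory Set

namespace Summit.RiemannHypothesis.RiemannHypothesis.Theorems.SuzukiThetaFlow

open Literature.NumberTheory.LFunctions
open Summit.RiemannHypothesis.RiemannHypothesis.Theorems.SuzukiCleanRadius (CleanUpTo)

/-! ## (T1) and the extension step (verbatim from the card) -/

/-- RH-FREE (definition, idea-2 verbatim). `‖f‖²_{L²(−t,t)}`. -/
def l2NormSq (t : ℝ) (f : ℝ → ℝ) : ℝ :=
  ∫ x in Ioo (-t) t, (f x) ^ 2

/-- RH-FREE (definition, idea-2 verbatim). **(T1) θ-ANTITONE WINDOW NORMS**: on the window `(−t,t)`,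
`θ ↦ ‖𝖪_θ[t] f‖²` is non-increasing on `(1,∞)` for every `f` (Loewner: `𝖪_{θ₁}[t]² ≤ 𝖪_{θ₀}[t]²`). -/
def NormSqAntitone (t : ℝ) : Prop :=
  ∀ θ₀ θ₁ : ℝ, 1 < θ₀ → θ₀ ≤ θ₁ → ∀ f : ℝ → ℝ, MemLp f 2 (winMeasure t) →
    winNormSq (limKernel θ₁) t f ≤ winNormSq (limKernel θ₀) t f

/-- RH-FREE (definition, idea-2 verbatim). The extension step: Weil positivity on smooth tests supported in `[−t,t]`
extends to the window outputs `g_θ` (inward mollification + dominated convergence). -/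
def WeilNonnegOnOutputs (t : ℝ) : Prop :=
  WeilPositivityOn t → ∀ θ : ℝ, 1 < θ → ∀ f : ℝ → ℝ, MemLp f 2 (winMeasure t) →
    0 ≤ (weilQuadratic (winOut θ t f)).re

/-- RH-FREE (definition, idea-2 verbatim). **(T1) TRANSFER, column 2 ⇒ column 6**: Weil positivity on the window of
half-width `t` makes Suzuki's window norms θ-antitone on that window. -/
def WeilWindowAntitone : Prop :=
  ∀ t : ℝ, 0 ≤ t → WeilPositivityOn t → NormSqAntitone t

/-- **RH-FREE · (T0) + positivity of `Re Q` on the outputs ⇒ (T1)** (the calculus step): if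
`d/dθ ‖𝖪_θ[t]f‖² = −2 Re Q(g_θ)` for `θ > 1` and `Re Q(g_θ) ≥ 0`, then `θ ↦ ‖𝖪_θ[t]f‖²` is non-increasing on `(1,∞)`
(`antitoneOn_of_deriv_nonpos` on the convex set `(1,∞)`). -/
theorem normSqAntitone_of_flow {t : ℝ} (hT0 : ThetaFlowIdentity t)
    (hpos : ∀ θ : ℝ, 1 < θ → ∀ f : ℝ → ℝ, MemLp f 2 (winMeasure t) → 0 ≤ (weilQuadratic (winOut θ t f)).re) :
    NormSqAntitone t := by
  intro θ₀ θ₁ hθ₀ hθ₀₁ f hf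
  set N : ℝ → ℝ := fun θ' => winNormSq (limKernel θ') t f with hN
  have hderiv : ∀ θ ∈ Ioi (1 : ℝ), HasDerivAt N (-2 * (weilQuadratic (winOut θ t f)).re) θ :=
    fun θ hθ => hT0 θ hθ f hf
  have hdiff : DifferentiableOn ℝ N (interior (Ioi (1 : ℝ))) := by
    rw [interior_Ioi]
    exact fun θ hθ => (hderiv θ hθ).differentiableAt.differentiableWithinAt
  have hcont : ContinuousOn N (Ioi (1 : ℝ)) :=
    fun θ hθ => (hderiv θ hθ).differentiableAt.continuousAt.continuousWithinAt
  have hnonpos : ∀ θ ∈ interior (Ioi (1 : ℝ)), deriv N θ ≤ 0 := by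
    rw [interior_Ioi]
    intro θ hθ
    rw [(hderiv θ hθ).deriv]
    have := hpos θ hθ f hf
    linarith
  have hanti := antitoneOn_of_deriv_nonpos (convex_Ioi (1 : ℝ)) hcont hdiff hnonpos
  exact hanti (mem_Ioi.2 hθ₀) (mem_Ioi.2 (lt_of_lt_of_le hθ₀ hθ₀₁)) hθ₀₁

/-- **RH-FREE · (T1) from the two named analytic statements**: `ThetaFlowIdentity t` and `WeilNonnegOnOutputs t` for
every `t ≥ 0` give `WeilWindowAntitone`. -/
theorem weilWindowAntitone_of (hT0 : ∀ t : ℝ, 0 ≤ t → ThetaFlowIdentity t)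
    (hext : ∀ t : ℝ, 0 ≤ t → WeilNonnegOnOutputs t) : WeilWindowAntitone :=
  fun t ht hW => normSqAntitone_of_flow (hT0 t ht) (hext t ht hW)

/-! ## Anchor, exclusion, uniform clean window (verbatim from the card; proofs idea-2's) -/

/-- RH-FREE (definition, idea-2 verbatim). Quadratic-form bound `‖𝖪_θ[t] f‖² ≤ q ‖f‖²` on the window (an ANCHOR
when `q < 1`; ET1b/ET1c certify `θ = 12`, `t ≤ 1.4` and `θ = 20`, `t ≤ 1.5` in two interval lineages). -/
def OpNormSqLe (θ t q : ℝ) : Prop :=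
  ∀ f : ℝ → ℝ, MemLp f 2 (winMeasure t) → winNormSq (limKernel θ) t f ≤ q * l2NormSq t f

/-- RH-FREE (definition, idea-2 verbatim). Anchor on every sub-window of `[0,T]`. -/
def Anchor (θ₀ T : ℝ) : Prop :=
  ∀ t : ℝ, 0 ≤ t → t ≤ T → ∃ q : ℝ, q < 1 ∧ OpNormSqLe θ₀ t q

/-- RH-FREE (definition, idea-2 verbatim). Strict contraction excludes the eigenvalues `±1`. -/
def ContractionExcludes : Prop :=
  ∀ θ t q : ℝ, q < 1 → OpNormSqLe θ t q → NoUnitEigenvalue (limKernel θ) t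

/-- RH-FREE · `ContractionExcludes` PROVED (idea-2's proof, K-free): an a.e. eigenfunction `𝖪f = ±f` has
`‖𝖪f‖² = ‖f‖² ≤ q‖f‖²` with `q < 1`, so `∫ f² = 0` and `f = 0` a.e. -/
theorem contractionExcludes : ContractionExcludes := by
  intro θ t q hq hle ε hε f hf hEig
  have hpt : ∀ᵐ x ∂(volume.restrict (Ioo (-t) t)),
      (winOp (limKernel θ) t f x) ^ 2 = (f x) ^ 2 := by
    filter_upwards [hEig] with x hx
    simp only [winOp]
    rw [hx]
    rcases hε with h | h <;> subst h <;> ring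
  have hsq_int : Integrable (fun x => (f x) ^ 2) (volume.restrict (Ioo (-t) t)) := hf.integrable_sq
  have hEq : winNormSq (limKernel θ) t f = l2NormSq t f := by
    unfold winNormSq l2NormSq
    exact integral_congr_ae hpt
  have hbound : winNormSq (limKernel θ) t f ≤ q * l2NormSq t f := hle f hf
  rw [hEq] at hbound
  have hnn : 0 ≤ l2NormSq t f := integral_nonneg (fun x => sq_nonneg (f x))
  have hle0 : l2NormSq t f ≤ 0 := by nlinarith
  have hzero : l2NormSq t f = 0 := le_antisymm hle0 hnn
  have hae : (fun x => (f x) ^ 2) =ᵐ[volume.restrict (Ioo (-t) t)] 0 :=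
    (integral_eq_zero_iff_of_nonneg (fun x => sq_nonneg (f x)) hsq_int).1 hzero
  filter_upwards [hae] with x hx
  have hx' : f x ^ 2 = 0 := by simpa using hx
  have hfx : f x = 0 := (pow_eq_zero_iff two_ne_zero).1 hx'
  simpa using hfx

/-- RH-FREE (definition, idea-2 verbatim). **θ-UNIFORM CLEAN WINDOW**: every window `0 ≤ t ≤ T` of `𝖪_θ` is free of
`±1` for EVERY `θ ≥ θ₀`. -/
def UniformCleanWindow (θ₀ T : ℝ) : Prop :=
  ∀ θ : ℝ, θ₀ ≤ θ → CleanUpTo θ T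

/-- RH-FREE · pure logic (idea-2's): θ-antitone norms on the windows `t ≤ T` + an anchor at `θ₀` + "contraction
excludes ±1" ⇒ the θ-uniform clean window `[0,T]` for all `θ ≥ θ₀`. -/
theorem uniformCleanWindow_of_antitone_anchor {θ₀ T : ℝ} (hθ₀ : 1 < θ₀)
    (hanti : ∀ t : ℝ, 0 ≤ t → t ≤ T → NormSqAntitone t)
    (hanchor : Anchor θ₀ T) (hexcl : ContractionExcludes) : UniformCleanWindow θ₀ T := by
  intro θ hθ t ht0 htT
  obtain ⟨q, hq, hle⟩ := hanchor t ht0 htT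
  refine hexcl θ t q hq ?_
  intro f hf
  exact le_trans (hanti t ht0 htT θ₀ θ hθ₀ hθ f hf) (hle f hf)

/-- RH-FREE (definition, idea-2 verbatim). **THE RUNG** (a θ-uniform instance-family of the residual's matrix, not the
residual): `∀ θ ≥ 12, CleanUpTo θ 1`. -/
def RungTwelveOne : Prop := UniformCleanWindow 12 1

/-- RH-FREE · the rung from (T1) + the anchor + the exclusion lemma (idea-2's); the Weil input is the TREE theorem
`WeilFormatCData.A1.weilPositivityOn_one`, monotone down to every `t ≤ 1`. -/
theorem rung_of (hT1 : WeilWindowAntitone) (hanchor : Anchor 12 1) (hexcl : ContractionExcludes) :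
    RungTwelveOne := by
  refine uniformCleanWindow_of_antitone_anchor (by norm_num) ?_ hanchor hexcl
  intro t ht0 ht1
  exact hT1 t ht0 (WeilPositivityOn.mono ht1
    Summit.RiemannHypothesis.RiemannHypothesis.Theorems.WeilFormatCData.A1.weilPositivityOn_one)

/-- RH-FREE · the rung with the exclusion lemma discharged (idea-2's). -/
theorem rung_of' (hT1 : WeilWindowAntitone) (hanchor : Anchor 12 1) : RungTwelveOne :=
  rung_of hT1 hanchor contractionExcludes

/-! ## Assembly: what the rung now rests on -/

/-- **RH-FREE · ASSEMBLY OF THE CHAIN AS IT STANDS IN THE TREE**: `RungTwelveOne` (`∀ θ ≥ 12`, every window `t ≤ 1` of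
`𝖪_θ` is free of `±1`) follows from (i) the explicit-formula pairing `FlowPairing t` and (ii) the extension step
`WeilNonnegOnOutputs t` on all windows `t ≥ 0`, and (iii) one anchor `Anchor 12 1` — everything else ((T0) from (i):
`thetaFlowIdentity_of_flowPairing`; (T1) from (T0)+(ii): `normSqAntitone_of_flow`; Weil positivity up to half-width `1`:
the tree's `weilPositivityOn_one`; exclusion of `±1`: `contractionExcludes`) being theorems.  (i), (ii) are RH-FREE
analytic statements not yet proved; (iii) is kit-certified (ET1b) but not a Lean theorem. -/
theorem rungTwelveOne_of_flowPairing (hpair : ∀ t : ℝ, 0 ≤ t → FlowPairing t)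
    (hext : ∀ t : ℝ, 0 ≤ t → WeilNonnegOnOutputs t) (hanchor : Anchor 12 1) : RungTwelveOne :=
  rung_of' (weilWindowAntitone_of (fun t ht => thetaFlowIdentity_of_flowPairing (hpair t ht)) hext) hanchor

end Summit.RiemannHypothesis.RiemannHypothesis.Theorems.SuzukiThetaFlow

end
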